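import Mathlib.AlgebraicGeometry.EllipticCurve.NormalForms
import Literature.NumberTheory.EllipticCurves.BSDSelmerSmithCases
import Literature.NumberTheory.EllipticCurves.BSDSelmerSmithIsogenyTrickConcreteProofs
import Literature.NumberTheory.EllipticCurves.IsogenyQuotientCurveProofs
import Literature.NumberTheory.EllipticCurves.TwoPowerTorsion
import Literature.NumberTheory.EllipticCurves.BSDInvariantsProofs
import HarnessLib

/-!
# Smith's case split (arXiv:2503.17619, Def. 1.6) is exhaustive, and the assembly of Thm. 1.1
# from its printed inputs ("Proof of Theorem 1.1", p. 4; proof of Thm. 1.7, §1.2)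

A `…Proofs` companion (theorems only) of `BSDSelmerSmithCases` (`Isogeny.IsBalanced`,
`ratTwoTorsionCard`, `smithCaseI`–`smithCaseV`) and of
`Literature.NumberTheory.EllipticCurves.BSDSelmer` §bsd.S34 (`smith_selmerCorank_density` =
A. Smith, arXiv:2503.17619 (2025), Thm. 1.1).

* §1 `2`-torsion over `ℚ`: `#E(ℚ)[2] ∈ {1, 2, 4}`; a `Γ_ℚ`-fixed point of order `2` spans the
  kernel of a degree-`2` `ℚ`-isogeny with an elliptic target (from the tree's quotient isogenies
  `exists_isogeny_ker_eq_and_comp_eq_nsmul_holds`, Silverman III.4.12); conversely the kernel of a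
  degree-`2` `ℚ`-isogeny is spanned by a `Γ_ℚ`-fixed `2`-torsion point, so when `#E(ℚ)[2] = 2`
  all degree-`2` isogenies on `E` have the same kernel ("the unique degree `2` `ℚ`-isogeny" of
  Def. 1.6).
* §2 Balanced isogenies: `ker ρ̄_{E,2}` in terms of `E[2]`; invariance of `ker ρ̄_{E,2}` and of
  `#E(ℚ)[2]` under a change of Weierstrass model; post-composing a balanced isogeny with a change
  of model of the target keeps it balanced with the same kernel; the dual (`φ' ∘ φ = [2]`) of a
  balanced isogeny is balanced ("it is also a balanced isogeny", proof of Thm. 1.7).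
* §3 **Exhaustiveness of Def. 1.6** (`smithCase_exhaustive`): every elliptic curve over `ℚ` is in
  (at least) one of Cases I–V.
* §4 **The assembly** (`smith_selmerCorank_density_of_printed_inputs`): Smith's Thm. 1.1 for
  *every* elliptic curve over `ℚ` follows from exactly the inputs named in the printed proof —
  Thm. 1.1 for curves in Cases I and II ("If `E` is in Case I or Case II, Theorem 1.1 follows for
  `E` from [Smi22a]"), the two conclusions of Thm. 1.17 (Case IV with its balanced isogeny; Case V
  with its two balanced isogenies), and "[Chil21]: if `E` is in Case V then `E_0` is in Case IV" —
  all as hypotheses, stated for models with `a₁ = a₃ = 0` (Smith's `y² = x³ + ax + b`; every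
  curve has such a model, `toCharNeTwoNF`) — together with the tree's route to the parity half of
  Thm. 1.1 (Modularity `exists_isNewformOf` and Monsky's congruence
  `monsky_selmerCorank_two_mod_two_eq`, `BSDSelmerSmithRootNumberDensityProofs`). The deductions
  used are the tree's: the isogeny trick with Prop. 1.18 (`smith_selmerCorank_density_of_thm117`,
  `…_of_thm117₂`, `BSDSelmerSmithIsogenyTrickConcreteProofs`), the isogeny invariance of Thm. 1.1
  and the Case III reduction (`smith_selmerCorank_density_of_isogeny`, `BSDSelmerSmithIsogenyProofs`).

Nothing here proves [Smi22a], Thm. 1.17 or [Chil21]; no named fact is introduced.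

## References

* [arXiv250317619] A. Smith, arXiv:2503.17619 (2025): §1.1 (Def. 1.6, Thm. 1.7, "Proof of
  Theorem 1.1" after Thm. 1.7), §1.2 (Thm. 1.17, Prop. 1.18, proof of Thm. 1.7).
* [SilvermanAEC2009] J. H. Silverman, *AEC*, 2nd ed., III.4.10–4.12, III.6.1–6.2, III.§7, VIII.§1.
* [Chil21] G. Chiloyan, Á. Lozano-Robledo, Trans. London Math. Soc. 8 (2021), 1–34.
* [Smi22a] A. Smith, arXiv:2207.05674 (2022).
-/

noncomputable section

open scoped Classical
open scoped AddSubgroup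

universe u

namespace WeierstrassCurve

open Literature.NumberTheory.EllipticCurves

/-! ## §1 Rational `2`-torsion and degree-`2` isogenies over `ℚ` -/

section TwoTorsion

variable (W : WeierstrassCurve ℚ)

/-- `#E[2] = 4` for an elliptic curve over `ℚ` (`card_geomTorsion_two_pow` at `k = 1`).
Silverman, *AEC*, III.6.4(b). [folklore] -/
theorem natCard_geomTorsion_two [W.IsElliptic] : Nat.card (geomTorsion W (2 : ℤ)) = 4 := by
  have h := card_geomTorsion_two_pow W two_ne_zero 1
  simpa using h

/-- The `Γ_ℚ`-fixed points of `E[2]` form a subgroup of `E[2]`; `ratTwoTorsionCard W` is its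
order. [folklore] -/
theorem ratTwoTorsionCard_eq_natCard_addSubgroup :
    ratTwoTorsionCard W =
      Nat.card (FixedPoints.addSubgroup (Field.absoluteGaloisGroup ℚ) (geomTorsion W (2 : ℤ))) :=
  rfl

/-- **`#E(ℚ)[2]` divides `4`** (`E(ℚ)[2] ≤ E[2]`, of order `4`). [folklore] -/
theorem ratTwoTorsionCard_dvd_four [W.IsElliptic] : ratTwoTorsionCard W ∣ 4 := by
  rw [ratTwoTorsionCard_eq_natCard_addSubgroup, ← natCard_geomTorsion_two W]
  exact AddSubgroup.card_addSubgroup_dvd_card _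

/-- **`#E(ℚ)[2] ∈ {1, 2, 4}`** for an elliptic curve over `ℚ` (the three possibilities
`E(ℚ)[2] = 0`, `ℤ/2ℤ`, `(ℤ/2ℤ)²` of Smith's Def. 1.6). [folklore] -/
theorem ratTwoTorsionCard_eq_one_or_two_or_four [W.IsElliptic] :
    ratTwoTorsionCard W = 1 ∨ ratTwoTorsionCard W = 2 ∨ ratTwoTorsionCard W = 4 := by
  have h := ratTwoTorsionCard_dvd_four W
  obtain ⟨k, hk, hk'⟩ := (Nat.dvd_prime_pow Nat.prime_two (m := 2)).mp (by simpa using h)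
  interval_cases k <;> simp_all

/-- A nonzero fixed point gives `#E(ℚ)[2] ≥ 2`; with `#E(ℚ)[2] = 2` it is the unique nonzero
fixed point. [folklore] -/
theorem eq_of_ratTwoTorsionCard_eq_two {W : WeierstrassCurve ℚ} (h : ratTwoTorsionCard W = 2)
    {Q Q' : geomTorsion W (2 : ℤ)} (hQ0 : Q ≠ 0)
    (hQ : ∀ σ : Field.absoluteGaloisGroup ℚ, σ • Q = Q) (hQ'0 : Q' ≠ 0)
    (hQ' : ∀ σ : Field.absoluteGaloisGroup ℚ, σ • Q' = Q') : Q = Q' := by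
  rw [ratTwoTorsionCard] at h
  obtain ⟨y, -, hy⟩ := (Nat.card_eq_two_iff'
    (⟨0, fun σ ↦ smul_zero σ⟩ : MulAction.fixedPoints (Field.absoluteGaloisGroup ℚ)
      (geomTorsion W (2 : ℤ)))).mp h
  have h1 := hy ⟨Q, hQ⟩ (fun e ↦ hQ0 (congrArg Subtype.val e))
  have h2 := hy ⟨Q', hQ'⟩ (fun e ↦ hQ'0 (congrArg Subtype.val e))
  exact congrArg Subtype.val (h1.trans h2.symm)

variable {W}

/-- In an additive group of order `2`, every element is `0` or the chosen nonzero element.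
[folklore] -/
theorem eq_zero_or_eq_of_natCard_eq_two {A : Type*} [AddGroup A] (hA : Nat.card A = 2) {x : A}
    (hx : x ≠ 0) (y : A) : y = 0 ∨ y = x := by
  obtain ⟨z, -, hz⟩ := (Nat.card_eq_two_iff' (0 : A)).mp hA
  by_cases hy : y = 0
  · exact Or.inl hy
  · exact Or.inr ((hz y hy).trans (hz x hx).symm)

/-- **The kernel of a degree-`2` `ℚ`-isogeny is spanned by a rational `2`-torsion point**: it is
`{O, Q}` with `Q ∈ E[2]`, `Q ≠ O`, fixed by `Γ_ℚ` (the kernel is `Γ_ℚ`-stable of order `2`).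
Silverman, *AEC*, III.4.12, Rem. III.4.13.2. [folklore] -/
theorem Isogeny.exists_ker_eq_zmultiples_of_degree_eq_two {W₀ : WeierstrassCurve ℚ}
    (φ : Isogeny W W₀) (hφ : φ.degree = 2) :
    ∃ Q : geomTorsion W (2 : ℤ), Q ≠ 0 ∧ (∀ σ : Field.absoluteGaloisGroup ℚ, σ • Q = Q) ∧
      φ.toAddMonoidHom.ker = AddSubgroup.zmultiples (Q : W.geomPoints) := by
  set K := φ.toAddMonoidHom.ker with hK_def
  have hK : Nat.card K = 2 := hφ
  obtain ⟨x, hx⟩ : ∃ x : K, x ≠ 0 := by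
    by_contra h
    push Not at h
    haveI : Subsingleton K := ⟨fun a b ↦ by rw [h a, h b]⟩
    have := Nat.card_of_subsingleton (0 : K)
    omega
  have hx0 : (x : W.geomPoints) ≠ 0 := fun e ↦ hx (Subtype.ext e)
  have hxK : φ (x : W.geomPoints) = 0 := by
    have h := x.2
    change (x : W.geomPoints) ∈ φ.toAddMonoidHom.ker at h
    rwa [AddMonoidHom.mem_ker] at h
  have hx2 : (2 : ℕ) • (x : W.geomPoints) = 0 := by
    rw [← AddSubgroupClass.coe_nsmul, ← hK, card_nsmul_eq_zero', ZeroMemClass.coe_zero]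
  have hall : ∀ y : K, y = 0 ∨ y = x := fun y ↦ eq_zero_or_eq_of_natCard_eq_two hK hx y
  have hall' : ∀ P : W.geomPoints, P ∈ K → P = 0 ∨ P = x := fun P hP ↦ by
    rcases hall ⟨P, hP⟩ with h0 | h1
    · exact Or.inl (congrArg Subtype.val h0)
    · exact Or.inr (congrArg Subtype.val h1)
  refine ⟨⟨x, AddSubgroup.torsionBy.nsmul_iff.mpr hx2⟩, fun e ↦ hx0 (congrArg Subtype.val e),
    fun σ ↦ Subtype.ext ?_, ?_⟩
  · -- `σ • x ∈ ker φ` is nonzero, hence equals `x`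
    change σ • (x : W.geomPoints) = x
    have hmem : σ • (x : W.geomPoints) ∈ K := by
      change σ • (x : W.geomPoints) ∈ φ.toAddMonoidHom.ker
      rw [AddMonoidHom.mem_ker, Isogeny.coe_toAddMonoidHom, φ.map_smul, hxK, smul_zero]
    have hne : σ • (x : W.geomPoints) ≠ 0 := fun e ↦ hx0 (by
      have := congrArg (fun P ↦ σ⁻¹ • P) e
      simpa only [inv_smul_smul, smul_zero] using this)
    rcases hall' _ hmem with h0 | h1
    · exact absurd h0 hne
    · exact h1
  · ext P
    change P ∈ K ↔ P ∈ AddSubgroup.zmultiples (x : W.geomPoints)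
    constructor
    · intro hP
      rcases hall' P hP with h0 | h1
      · rw [h0]; exact zero_mem _
      · rw [h1]; exact AddSubgroup.mem_zmultiples _
    · rintro ⟨k, rfl⟩
      exact K.zsmul_mem x.2 k

variable (W)

/-- **A rational point of order `2` spans the kernel of a degree-`2` `ℚ`-isogeny to an elliptic
curve, with its dual**: for `Q ∈ E[2]`, `Q ≠ O`, fixed by `Γ_ℚ`, there are an elliptic curve
`E_0 / ℚ` and `ℚ`-isogenies `φ : E → E_0`, `φ' : E_0 → E` with `ker φ = {O, Q}`, `deg φ = 2`,
`φ' ∘ φ = [2]`, `φ ∘ φ' = [2]` — the quotient `E → E/⟨Q⟩` (Silverman III.4.12 with Rem. III.4.13.2;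
tree theorem `exists_isogeny_ker_eq_and_comp_eq_nsmul_holds`, `IsogenyQuotientCurveProofs`). This
is "the unique degree `2` `ℚ`-isogeny" of Smith's Def. 1.6 for `E(ℚ)[2] ≅ ℤ/2ℤ`.
[cite: SilvermanAEC2009, Prop. III.4.12 with Rem. III.4.13.2] -/
theorem exists_isogeny_degree_two_of_fixed [W.IsElliptic] {Q : geomTorsion W (2 : ℤ)} (hQ0 : Q ≠ 0)
    (hQ : ∀ σ : Field.absoluteGaloisGroup ℚ, σ • Q = Q) :
    ∃ (W₀ : WeierstrassCurve ℚ) (_ : W₀.IsElliptic) (φ : Isogeny W W₀) (φ' : Isogeny W₀ W),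
      φ.toAddMonoidHom.ker = AddSubgroup.zmultiples (Q : W.geomPoints) ∧ φ.degree = 2 ∧
        (∀ P, φ' (φ P) = (2 : ℤ) • P) ∧ ∀ P', φ (φ' P') = (2 : ℤ) • P' := by
  set S : AddSubgroup W.geomPoints := AddSubgroup.zmultiples (Q : W.geomPoints) with hS_def
  have hQ2 : (2 : ℕ) • (Q : W.geomPoints) = 0 := AddSubgroup.torsionBy.nsmul_iff.mp
    (show (Q : W.geomPoints) ∈ geomTorsion W ((2 : ℕ) : ℤ) from Q.2)
  have hQ0' : (Q : W.geomPoints) ≠ 0 := fun e ↦ hQ0 (Subtype.ext e)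
  have hord : addOrderOf (Q : W.geomPoints) = 2 := addOrderOf_eq_prime hQ2 hQ0'
  have hcard : Nat.card S = 2 := by rw [hS_def, Nat.card_zmultiples, hord]
  haveI : Finite S := Nat.finite_of_card_ne_zero (by rw [hcard]; decide)
  have hfin : (S : Set W.geomPoints).Finite := Set.toFinite _
  have hσQ : ∀ σ : Field.absoluteGaloisGroup ℚ, σ • (Q : W.geomPoints) = Q := fun σ ↦
    congrArg Subtype.val (hQ σ)
  have hstab : ∀ (σ : Field.absoluteGaloisGroup ℚ) (P : W.geomPoints), P ∈ S → σ • P ∈ S := by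
    rintro σ _ ⟨k, rfl⟩
    refine ⟨k, ?_⟩
    have h : σ • (k • (Q : W.geomPoints)) = k • (σ • (Q : W.geomPoints)) :=
      map_zsmul (DistribSMul.toAddMonoidHom W.geomPoints σ) k _
    change k • (Q : W.geomPoints) = σ • (k • (Q : W.geomPoints))
    rw [h, hσQ]
  obtain ⟨W₀, hW₀, g, f, hker, hfg, hgf⟩ := W.exists_isogeny_ker_eq_and_comp_eq_nsmul_holds S hfin hstab
  refine ⟨W₀, hW₀, g, f, hker, ?_, fun P ↦ ?_, fun P' ↦ ?_⟩
  · change Nat.card g.toAddMonoidHom.ker = 2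
    rw [hker, hcard]
  · rw [hfg P, hcard, ← natCast_zsmul]; rfl
  · rw [hgf P', hcard, ← natCast_zsmul]; rfl

/-- With `#E(ℚ)[2] = 2`, **all degree-`2` `ℚ`-isogenies on `E` have the same kernel** (namely
`E(ℚ)[2]`): "the unique degree `2` `ℚ`-isogeny" of Smith's Def. 1.6. [folklore] -/
theorem Isogeny.ker_eq_ker_of_degree_eq_two {W₁ W₂ : WeierstrassCurve ℚ}
    (h : ratTwoTorsionCard W = 2) (φ₁ : Isogeny W W₁) (φ₂ : Isogeny W W₂) (h₁ : φ₁.degree = 2)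
    (h₂ : φ₂.degree = 2) : φ₁.toAddMonoidHom.ker = φ₂.toAddMonoidHom.ker := by
  obtain ⟨Q₁, hQ₁0, hQ₁, hk₁⟩ := φ₁.exists_ker_eq_zmultiples_of_degree_eq_two h₁
  obtain ⟨Q₂, hQ₂0, hQ₂, hk₂⟩ := φ₂.exists_ker_eq_zmultiples_of_degree_eq_two h₂
  rw [hk₁, hk₂, eq_of_ratTwoTorsionCard_eq_two h hQ₁0 hQ₁ hQ₂0 hQ₂]

/-- A degree-`2` `ℚ`-isogeny on `E` forces `#E(ℚ)[2] ≠ 1` (its kernel contains a rational point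
of order `2`). [folklore] -/
theorem Isogeny.ratTwoTorsionCard_ne_one_of_degree_eq_two [W.IsElliptic] {W₀ : WeierstrassCurve ℚ}
    (φ : Isogeny W W₀) (hφ : φ.degree = 2) : ratTwoTorsionCard W ≠ 1 := by
  obtain ⟨Q, hQ0, hQ, -⟩ := φ.exists_ker_eq_zmultiples_of_degree_eq_two hφ
  intro h
  rw [ratTwoTorsionCard] at h
  haveI := (Nat.card_eq_one_iff_unique.mp h).1
  have e : (⟨Q, hQ⟩ : MulAction.fixedPoints (Field.absoluteGaloisGroup ℚ) (geomTorsion W (2 : ℤ))) =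
      ⟨0, fun σ ↦ smul_zero σ⟩ := Subsingleton.elim _ _
  exact hQ0 (congrArg Subtype.val e)

end TwoTorsion

/-! ## §2 Balanced isogenies: changes of model and duals -/

section Balanced

variable {W W₀ : WeierstrassCurve ℚ}

/-- `σ ∈ ker ρ̄_{E,n}` iff `σ` fixes `E[n]` pointwise (local copy of the unfolding of
`galoisRepTorsion`). [folklore] -/
private theorem mem_ker_galoisRepTorsion_iff (W : WeierstrassCurve ℚ) (n : ℤ)
    (σ : Field.absoluteGaloisGroup ℚ) :
    σ ∈ (W.galoisRepTorsion n).ker ↔ ∀ P : geomTorsion W n, σ • P = P := by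
  rw [MonoidHom.mem_ker]
  constructor
  · intro h P
    rw [← galoisRepTorsion_apply, h]
    rfl
  · intro h
    refine Multiplicative.toAdd.injective (AddEquiv.ext fun P ↦ ?_)
    rw [galoisRepTorsion_apply]
    exact h P

/-- **`E[n] ≃ (C • E)[n]`, `Γ_ℚ`-equivariantly**: the isomorphism of geometric points of a change
of model `E' = C • E` (`geomPointsEquiv`, equivariant) restricts to the `n`-torsion. [folklore] -/
theorem exists_geomTorsion_addEquiv_smul (W : WeierstrassCurve ℚ) (C : VariableChange ℚ) (n : ℤ) :
    ∃ e : geomTorsion W n ≃+ geomTorsion (C • W) n,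
      ∀ (σ : Field.absoluteGaloisGroup ℚ) (P : geomTorsion W n), e (σ • P) = σ • e P := by
  have hmap : (geomTorsion W n).map (geomPointsEquiv W C : W.geomPoints →+ (C • W).geomPoints) =
      geomTorsion (C • W) n := by
    ext P
    constructor
    · rintro ⟨Q, hQ, rfl⟩
      have hQ' : n • Q = 0 := (Submodule.mem_torsionBy_iff _ _).mp hQ
      exact (Submodule.mem_torsionBy_iff _ _).mpr (show n • geomPointsEquiv W C Q = 0 by
        rw [← map_zsmul, hQ', map_zero])
    · intro hP
      refine ⟨(geomPointsEquiv W C).symm P, ?_, AddEquiv.apply_symm_apply _ _⟩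
      have hP' : n • P = 0 := (Submodule.mem_torsionBy_iff _ _).mp hP
      exact (Submodule.mem_torsionBy_iff _ _).mpr (show n • (geomPointsEquiv W C).symm P = 0 by
        rw [← map_zsmul, hP', map_zero])
  refine ⟨((geomPointsEquiv W C).addSubgroupMap (geomTorsion W n)).trans
    (AddEquiv.addSubgroupCongr hmap), fun σ P ↦ Subtype.ext ?_⟩
  change geomPointsEquiv W C ((σ • P : geomTorsion W n) : W.geomPoints) =
    σ • geomPointsEquiv W C (P : W.geomPoints)
  rw [Literature.NumberTheory.EllipticCurves.AddSubgroup.torsionBy.coe_smul, geomPointsEquiv_smul]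

/-- **`ker ρ̄_{E,n}` does not depend on the Weierstrass model**: for a change of variables `C`
over `ℚ`, `ker ρ̄_{C • E, n} = ker ρ̄_{E, n}` (`E[n] ≃ (C • E)[n]` `Γ_ℚ`-equivariantly). So
`ℚ(E[2])`, and the notion of balanced isogeny, are attached to the curve. [folklore] -/
theorem ker_galoisRepTorsion_smul (W : WeierstrassCurve ℚ) (C : VariableChange ℚ) (n : ℤ) :
    ((C • W).galoisRepTorsion n).ker = (W.galoisRepTorsion n).ker := by
  obtain ⟨e, he⟩ := exists_geomTorsion_addEquiv_smul W C n
  ext σ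
  rw [mem_ker_galoisRepTorsion_iff, mem_ker_galoisRepTorsion_iff]
  constructor
  · intro h P
    apply e.injective
    rw [he, h]
  · intro h P'
    obtain ⟨P, rfl⟩ := e.surjective P'
    rw [← he, h]

/-- **`#E(ℚ)[2]` does not depend on the Weierstrass model.** [folklore] -/
theorem ratTwoTorsionCard_smul (W : WeierstrassCurve ℚ) (C : VariableChange ℚ) :
    ratTwoTorsionCard (C • W) = ratTwoTorsionCard W := by
  obtain ⟨e, he⟩ := exists_geomTorsion_addEquiv_smul W C 2
  unfold ratTwoTorsionCard
  symm
  refine Nat.card_congr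
    { toFun := fun P ↦ ⟨e P.1, fun σ ↦ by rw [← he, P.2 σ]⟩
      invFun := fun P' ↦ ⟨e.symm P'.1, fun σ ↦ ?_⟩
      left_inv := fun P ↦ Subtype.ext (e.symm_apply_apply _)
      right_inv := fun P' ↦ Subtype.ext (e.apply_symm_apply _) }
  apply e.injective
  rw [he, AddEquiv.apply_symm_apply, P'.2 σ]

namespace Isogeny

/-- Post-composing with a change of model of the target does not change the kernel.
[folklore] -/
theorem ker_toIsogeny_comp (φ : Isogeny W W₀) (C : VariableChange ℚ) :
    ((VariableChange.toIsogeny W₀ C).comp φ).toAddMonoidHom.ker = φ.toAddMonoidHom.ker := by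
  rw [Isogeny.ker_comp, VariableChange.ker_toIsogeny, AddMonoidHom.comap_bot]

/-- Post-composing with a change of model of the target does not change the degree. [folklore] -/
theorem degree_toIsogeny_comp (φ : Isogeny W W₀) (C : VariableChange ℚ) :
    ((VariableChange.toIsogeny W₀ C).comp φ).degree = φ.degree := by
  unfold Isogeny.degree
  rw [ker_toIsogeny_comp]

/-- **A balanced isogeny stays balanced after a change of model of the target** (same degree,
`ℚ((C • E_0)[2]) = ℚ(E_0[2])`). [cite: arXiv250317619, Def. 1.6] -/
theorem IsBalanced.toIsogeny_comp {φ : Isogeny W W₀} (h : φ.IsBalanced) (C : VariableChange ℚ) :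
    ((VariableChange.toIsogeny W₀ C).comp φ).IsBalanced :=
  ⟨(degree_toIsogeny_comp φ C).trans h.1, h.2.trans (ker_galoisRepTorsion_smul W₀ C 2).symm⟩

/-- If `ψ ∘ φ = [2]` on `E(ℚ̄)` for isogenies of elliptic curves then `φ ∘ ψ = [2]` on `E_0(ℚ̄)`
(`φ` is onto). Silverman, *AEC*, III.6.2(a). The case `n = 2` of `comp_dual_apply_eq_zsmul`
(`SelmerCorankIsogenyProofs`, in the import closure); deprecated restatement (dedup-01132,
2026-08-16). [folklore] -/
@[deprecated comp_dual_apply_eq_zsmul (since := "2026-08-16")]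
theorem comp_apply_eq_two_zsmul [W.IsElliptic] [W₀.IsElliptic] (φ : Isogeny W W₀)
    (ψ : Isogeny W₀ W) (h : ∀ P, ψ (φ P) = (2 : ℤ) • P) (Q : W₀.geomPoints) :
    φ (ψ Q) = (2 : ℤ) • Q :=
  comp_dual_apply_eq_zsmul φ h Q

/-- **The dual of a degree-`2` isogeny has degree `2`**: if `ψ ∘ φ = [2]` with `deg φ = 2` then
`deg ψ = 2` (`#ker (ψ ∘ φ) = #E[2] = 4 = #ker ψ · #ker φ`, `φ` onto). Silverman, *AEC*,
III.6.2(e). [folklore] -/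
theorem degree_eq_two_of_comp_eq_two [W.IsElliptic] [W₀.IsElliptic] (φ : Isogeny W W₀)
    (ψ : Isogeny W₀ W) (h : ∀ P, ψ (φ P) = (2 : ℤ) • P) (hφ : φ.degree = 2) : ψ.degree = 2 := by
  set F := φ.toAddMonoidHom with hF
  set G := ψ.toAddMonoidHom with hG
  -- `ker (G ∘ F) = E[2]`
  have hker : (G.comp F).ker = geomTorsion W (2 : ℤ) := by
    ext P
    rw [AddMonoidHom.mem_ker, AddMonoidHom.comp_apply]
    change ψ (φ P) = 0 ↔ P ∈ geomTorsion W (2 : ℤ)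
    rw [h P]
    exact (Submodule.mem_torsionBy_iff _ _).symm
  -- `#ker (G ∘ F) = #ker G · #ker F`
  have hFsurj : Function.Surjective F := φ.surjective
  have hcount : Nat.card (G.comp F).ker = Nat.card G.ker * Nat.card F.ker := by
    have hle : F.ker ≤ (G.comp F).ker := fun x hx ↦ by
      rw [AddMonoidHom.mem_ker] at hx
      rw [AddMonoidHom.mem_ker, AddMonoidHom.comp_apply, hx, map_zero]
    have h1 : F.ker.relIndex (G.comp F).ker = Nat.card G.ker := by
      rw [← AddMonoidHom.comap_bot, show (G.comp F).ker = G.ker.comap F from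
        (AddMonoidHom.comap_ker G F).symm, AddSubgroup.relIndex_comap,
        AddSubgroup.map_comap_eq_self_of_surjective hFsurj, AddSubgroup.relIndex_bot_left]
    have h2 := AddSubgroup.relIndex_mul_relIndex (H := ⊥) (K := F.ker) (L := (G.comp F).ker)
      bot_le hle
    rw [AddSubgroup.relIndex_bot_left, AddSubgroup.relIndex_bot_left, h1] at h2
    rw [← h2, mul_comm]
  rw [hker, natCard_geomTorsion_two W] at hcount
  have hφ' : Nat.card F.ker = 2 := hφ
  rw [hφ'] at hcount
  change Nat.card G.ker = 2
  omega

/-- **The dual of a balanced isogeny is balanced** ("it is also a balanced isogeny", Smith,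
arXiv:2503.17619, proof of Thm. 1.7): if `φ : E → E_0` is balanced and `φ' ∘ φ = [2]` then
`φ' : E_0 → E` is balanced. [cite: arXiv250317619, §1.2 (proof of Thm. 1.7)] -/
theorem IsBalanced.of_comp_eq_two [W.IsElliptic] [W₀.IsElliptic] {φ : Isogeny W W₀}
    (hφ : φ.IsBalanced) (ψ : Isogeny W₀ W) (h : ∀ P, ψ (φ P) = (2 : ℤ) • P) : ψ.IsBalanced :=
  ⟨degree_eq_two_of_comp_eq_two φ ψ h hφ.1, hφ.2.symm⟩

/-- A balanced isogeny has a "dual" `φ'` with `φ' ∘ φ = [2]` (Silverman III.6.1(a); tree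
`Isogeny.exists_dual_of_isElliptic`, `deg φ = 2`). [folklore] -/
theorem IsBalanced.exists_comp_eq_two [W.IsElliptic] [W₀.IsElliptic] {φ : Isogeny W W₀}
    (hφ : φ.IsBalanced) : ∃ ψ : Isogeny W₀ W, ∀ P, ψ (φ P) = (2 : ℤ) • P := by
  obtain ⟨ψ, hψ⟩ := φ.exists_dual_of_isElliptic
  refine ⟨ψ, fun P ↦ ?_⟩
  rw [hψ P, hφ.1, Nat.cast_ofNat]

end Isogeny

end Balanced

end WeierstrassCurve

/-! ## §3 Def. 1.6 is exhaustive -/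

namespace Literature.NumberTheory.EllipticCurves

open WeierstrassCurve Literature.NumberTheory.EllipticCurves.ModularForms

/-- **Every elliptic curve over `ℚ` is in one of Smith's Cases I–V** (arXiv:2503.17619,
Def. 1.6). By `#E(ℚ)[2] ∈ {1, 2, 4}`: `1` is Case I; for `2`, the quotient by the rational
`2`-torsion point is "the" degree-`2` isogeny `φ : E → E_0` and one is in Case III, IV or II
according as `#E_0(ℚ)[2] = 4`, `φ` is balanced, or neither (all degree-`2` isogenies on `E`
having the same kernel); for `4`, either no isogeny on `E` is balanced (Case I), or all balanced
ones share a kernel (Case IV), or two do not (Case V). [cite: arXiv250317619, Def. 1.6] -/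
theorem smithCase_exhaustive (W : WeierstrassCurve ℚ) [W.IsElliptic] :
    smithCaseI W ∨ smithCaseII W ∨ smithCaseIII W ∨ smithCaseIV W ∨ smithCaseV W := by
  rcases ratTwoTorsionCard_eq_one_or_two_or_four W with h1 | h2 | h4
  · exact Or.inl (Or.inl h1)
  · -- a nonzero fixed `2`-torsion point and the isogeny it spans
    obtain ⟨y, hy, -⟩ := (Nat.card_eq_two_iff'
      (⟨0, fun σ ↦ smul_zero σ⟩ : MulAction.fixedPoints (Field.absoluteGaloisGroup ℚ)
        (geomTorsion W (2 : ℤ)))).mp h2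
    have hy0 : (y : geomTorsion W (2 : ℤ)) ≠ 0 := fun e ↦ hy (Subtype.ext e)
    obtain ⟨W₀, hW₀, φ, φ', -, hdeg, -, -⟩ := exists_isogeny_degree_two_of_fixed W hy0 y.2
    by_cases hc : ratTwoTorsionCard W₀ = 4
    · exact Or.inr (Or.inr (Or.inl ⟨h2, W₀, hW₀, φ, hdeg, hc⟩))
    · by_cases hb : φ.IsBalanced
      · refine Or.inr (Or.inr (Or.inr (Or.inl ⟨⟨W₀, hW₀, φ, hb⟩, ?_⟩)))
        intro W₁ W₂ _ _ φ₁ φ₂ hb₁ hb₂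
        exact Isogeny.ker_eq_ker_of_degree_eq_two W h2 φ₁ φ₂ hb₁.1 hb₂.1
      · exact Or.inr (Or.inl ⟨h2, W₀, hW₀, φ, hdeg, hb, hc⟩)
  · by_cases hex : ∃ (W₀ : WeierstrassCurve ℚ) (_ : W₀.IsElliptic) (φ : Isogeny W W₀), φ.IsBalanced
    · obtain ⟨W₀, hW₀, φ, hφ⟩ := hex
      haveI := hW₀
      rcases smithCaseIV_or_smithCaseV_of_isBalanced φ hφ with h | h
      · exact Or.inr (Or.inr (Or.inr (Or.inl h)))
      · exact Or.inr (Or.inr (Or.inr (Or.inr h)))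
    · push Not at hex
      exact Or.inl (Or.inr ⟨h4, fun W₀ _ φ ↦ hex W₀ ‹_› φ⟩)

/-- In Case III the `ℚ`-isogenous curve `E_0` is in Case I, IV or V ("there is a `ℚ` isogeny
`φ : E → E_0` to a curve `E_0` in either Case I, IV, or V", Smith §1.1): `#E_0(ℚ)[2] = 4` rules
out Cases II and III. [cite: arXiv250317619, §1.1 (Case III reduction)] -/
theorem smithCaseI_or_IV_or_V_of_ratTwoTorsionCard_eq_four (W₀ : WeierstrassCurve ℚ)
    [W₀.IsElliptic] (h : ratTwoTorsionCard W₀ = 4) :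
    smithCaseI W₀ ∨ smithCaseIV W₀ ∨ smithCaseV W₀ := by
  rcases smithCase_exhaustive W₀ with hI | hII | hIII | hIV | hV
  · exact Or.inl hI
  · exact absurd (hII.1.symm.trans h) (by decide)
  · exact absurd (hIII.1.symm.trans h) (by decide)
  · exact Or.inr (Or.inl hIV)
  · exact Or.inr (Or.inr hV)

/-! ## §4 The assembly: Thm. 1.1 for every `E/ℚ` from the printed inputs -/

section Assembly

variable
  (hmod : exists_isNewformOf) (hMon : monsky_selmerCorank_two_mod_two_eq)
  (hSmi : ∀ (E : WeierstrassCurve ℚ) [E.IsElliptic] [E.IsCharNeTwoNF],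
    smithCaseI E ∨ smithCaseII E → smith_selmerCorank_density E)
  (h17IV : ∀ (E E₀ : WeierstrassCurve ℚ) [E.IsElliptic] [E₀.IsElliptic] [E.IsCharNeTwoNF]
    [E₀.IsCharNeTwoNF] (φ : Isogeny E E₀) (φ' : Isogeny E₀ E),
    smithCaseIV E → φ.IsBalanced → (∀ P, φ' (φ P) = (2 : ℤ) • P) →
      twistDensity (fun d ↦ d ≠ 0 ∧
        (selmerCorankTwoInfty (E.quadraticTwist d) ≤ 1 ∨
          (selmerCorankTwoInfty (E.quadraticTwist d) = φ.twistDivRank d ∧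
            2 ≤ φ.twistDivRank d))) 1)
  (h17V : ∀ (E E₁ E₂ : WeierstrassCurve ℚ) [E.IsElliptic] [E₁.IsElliptic] [E₂.IsElliptic]
    [E.IsCharNeTwoNF] [E₁.IsCharNeTwoNF] [E₂.IsCharNeTwoNF] (φ₁ : Isogeny E E₁) (φ₂ : Isogeny E E₂),
    smithCaseV E → φ₁.IsBalanced → φ₂.IsBalanced →
      φ₁.toAddMonoidHom.ker ≠ φ₂.toAddMonoidHom.ker →
      twistDensity (fun d ↦ d ≠ 0 ∧
        (selmerCorankTwoInfty (E.quadraticTwist d) ≤ 1 ∨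
          (selmerCorankTwoInfty (E.quadraticTwist d) = φ₁.twistDivRank d ∧
            2 ≤ φ₁.twistDivRank d) ∨
          (selmerCorankTwoInfty (E.quadraticTwist d) = φ₂.twistDivRank d ∧
            2 ≤ φ₂.twistDivRank d))) 1)
  (hChil : ∀ (E E₁ : WeierstrassCurve ℚ) [E.IsElliptic] [E₁.IsElliptic] (φ : Isogeny E E₁),
    smithCaseV E → φ.IsBalanced → smithCaseIV E₁)

include hmod hMon h17IV h17V hChil in
/-- **Case V** (proof of Thm. 1.7, §1.2, Case V branch; then Thm. 1.1): for `E` in Case V given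
by a model with `a₁ = a₃ = 0`, take its two balanced isogenies `φᵢ : E → Eᵢ` (targets put in
`a₁ = a₃ = 0` form), their duals `φᵢ'`; by the [Chil21] input the `Eᵢ` are in Case IV with
balanced isogeny `φᵢ'`; Thm. 1.17 for `E` (Case V form) and for `E₁`, `E₂` (Case IV form) feed
the isogeny trick with Prop. 1.18 (`smith_selmerCorank_density_of_thm117₂`).
[cite: arXiv250317619, §1.2 (proof of Thm. 1.7) and Thm. 1.1] -/
theorem smith_selmerCorank_density_of_smithCaseV (E : WeierstrassCurve ℚ) [E.IsElliptic]
    [E.IsCharNeTwoNF] (hV : smithCaseV E) : smith_selmerCorank_density E := by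
  obtain ⟨W₁, W₂, hW₁, hW₂, φ₁, φ₂, hb₁, hb₂, hne⟩ := hV
  obtain ⟨C₁, hC₁⟩ := exists_variableChange_isCharNeTwoNF W₁
  obtain ⟨C₂, hC₂⟩ := exists_variableChange_isCharNeTwoNF W₂
  haveI := hC₁
  haveI := hC₂
  set φ₁s : Isogeny E (C₁ • W₁) := (VariableChange.toIsogeny W₁ C₁).comp φ₁ with hφ₁s
  set φ₂s : Isogeny E (C₂ • W₂) := (VariableChange.toIsogeny W₂ C₂).comp φ₂ with hφ₂s
  have hb₁s : φ₁s.IsBalanced := hb₁.toIsogeny_comp C₁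
  have hb₂s : φ₂s.IsBalanced := hb₂.toIsogeny_comp C₂
  have hnes : φ₁s.toAddMonoidHom.ker ≠ φ₂s.toAddMonoidHom.ker := by
    rwa [hφ₁s, hφ₂s, Isogeny.ker_toIsogeny_comp, Isogeny.ker_toIsogeny_comp]
  obtain ⟨ψ₁, hψ₁⟩ := hb₁s.exists_comp_eq_two
  obtain ⟨ψ₂, hψ₂⟩ := hb₂s.exists_comp_eq_two
  have hV' : smithCaseV E := ⟨_, _, inferInstance, inferInstance, φ₁s, φ₂s, hb₁s, hb₂s, hnes⟩
  have hIV₁ : smithCaseIV (C₁ • W₁) := hChil E _ φ₁s hV' hb₁s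
  have hIV₂ : smithCaseIV (C₂ • W₂) := hChil E _ φ₂s hV' hb₂s
  have hE := h17V E (C₁ • W₁) (C₂ • W₂) φ₁s φ₂s hV' hb₁s hb₂s hnes
  have hE₁ := h17IV (C₁ • W₁) E ψ₁ φ₁s hIV₁ (hb₁s.of_comp_eq_two ψ₁ hψ₁)
    (Isogeny.comp_dual_apply_eq_zsmul φ₁s hψ₁)
  have hE₂ := h17IV (C₂ • W₂) E ψ₂ φ₂s hIV₂ (hb₂s.of_comp_eq_two ψ₂ hψ₂)
    (Isogeny.comp_dual_apply_eq_zsmul φ₂s hψ₂)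
  exact (smith_selmerCorank_density_of_thm117₂ hmod hMon φ₁s ψ₁ hψ₁ φ₂s ψ₂ hψ₂ hE hE₁ hE₂).1

include hmod hMon h17IV h17V hChil in
/-- **Case IV** (proof of Thm. 1.7, §1.2, Case IV branch; then Thm. 1.1): for `E` in Case IV
given by a model with `a₁ = a₃ = 0`, take its balanced isogeny `φ : E → E_0` (target in
`a₁ = a₃ = 0` form) and its dual `φ'`, also balanced; `E_0` is in Case IV or V. If Case IV,
Thm. 1.17 for `E` and `E_0` feed the isogeny trick with Prop. 1.18
(`smith_selmerCorank_density_of_thm117`); if Case V, Thm. 1.1 holds for `E_0` by the Case V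
branch and passes to the isogenous `E` ("by considering the isogenous curve and applying
Prop. 1.18 if necessary, we may assume that `E` is either in Case V or is not isogenous to a
curve in Case V"). [cite: arXiv250317619, §1.2 (proof of Thm. 1.7) and Thm. 1.1] -/
theorem smith_selmerCorank_density_of_smithCaseIV (E : WeierstrassCurve ℚ) [E.IsElliptic]
    [E.IsCharNeTwoNF] (hIV : smithCaseIV E) : smith_selmerCorank_density E := by
  obtain ⟨W₀, hW₀, φ, hb⟩ := hIV.1
  obtain ⟨C, hC⟩ := exists_variableChange_isCharNeTwoNF W₀
  haveI := hC
  set φs : Isogeny E (C • W₀) := (VariableChange.toIsogeny W₀ C).comp φ with hφs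
  have hbs : φs.IsBalanced := hb.toIsogeny_comp C
  obtain ⟨ψ, hψ⟩ := hbs.exists_comp_eq_two
  have hψb : ψ.IsBalanced := hbs.of_comp_eq_two ψ hψ
  rcases smithCaseIV_or_smithCaseV_of_isBalanced ψ hψb with h₀ | h₀
  · have h₁₇ := h17IV E (C • W₀) φs ψ hIV hbs hψ
    have h₁₇' := h17IV (C • W₀) E ψ φs h₀ hψb (Isogeny.comp_dual_apply_eq_zsmul φs hψ)
    exact (smith_selmerCorank_density_of_thm117 hmod hMon φs ψ hψ h₁₇ h₁₇').1
  · exact smith_selmerCorank_density_of_isogeny φs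
      (smith_selmerCorank_density_of_smithCaseV hmod hMon h17IV h17V hChil (C • W₀) h₀)

include hmod hMon hSmi h17IV h17V hChil in
/-- **Case III** (Smith §1.1: "if `E` is in Case III, there is a `ℚ` isogeny `φ : E → E_0` to a
curve `E_0` in either Case I, IV, or V … Theorem 1.1 will follow for `E` since it holds for
`E_0`"): `E_0` (in `a₁ = a₃ = 0` form) has `#E_0(ℚ)[2] = 4`, hence is in Case I, IV or V, where
Thm. 1.1 holds by the [Smi22a] input resp. the two branches above; it passes to `E` along `φ`
(`smith_selmerCorank_density_of_isogeny`). [cite: arXiv250317619, §1.1 (Case III reduction)] -/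
theorem smith_selmerCorank_density_of_smithCaseIII (E : WeierstrassCurve ℚ) [E.IsElliptic]
    (hIII : smithCaseIII E) : smith_selmerCorank_density E := by
  obtain ⟨-, W₀, hW₀, φ, -, h4⟩ := hIII
  obtain ⟨C, hC⟩ := exists_variableChange_isCharNeTwoNF W₀
  haveI := hC
  have h4s : ratTwoTorsionCard (C • W₀) = 4 := (ratTwoTorsionCard_smul W₀ C).trans h4
  have h₀ : smith_selmerCorank_density (C • W₀) := by
    rcases smithCaseI_or_IV_or_V_of_ratTwoTorsionCard_eq_four (C • W₀) h4s with hI | hIV | hV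
    · exact hSmi _ (Or.inl hI)
    · exact smith_selmerCorank_density_of_smithCaseIV hmod hMon h17IV h17V hChil _ hIV
    · exact smith_selmerCorank_density_of_smithCaseV hmod hMon h17IV h17V hChil _ hV
  exact smith_selmerCorank_density_of_isogeny ((VariableChange.toIsogeny W₀ C).comp φ) h₀

include hmod hMon hSmi h17IV h17V hChil in
/-- **Smith's Theorem 1.1 for every elliptic curve over `ℚ`, from the inputs named in its
printed proof** (arXiv:2503.17619, "Proof of Theorem 1.1", §1.1 p. 4, with the proof of Thm. 1.7,
§1.2). Hypotheses, all for models with `a₁ = a₃ = 0` (Smith's `y² = x³ + ax + b`; every curve has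
one, `exists_variableChange_isCharNeTwoNF`, and Thm. 1.1 is model- and isogeny-invariant):
* `hSmi` — *"If `E` is in Case I or Case II, Theorem 1.1 follows for `E` from [Smi22a]"*;
* `h17IV`, `h17V` — the two printed conclusions of **Thm. 1.17** (Case IV: with the balanced
  isogeny `φ`, for `100 %` of squarefree `d`, `r_{2^∞}(E^d) ≤ 1` or
  `r_{2^∞}(E^d) = r_{φ,div}(E^d) ≥ 2`; Case V: with the two balanced isogenies `φ₁, φ₂`, the
  three-way alternative), on the tree's `r_{2^∞}` and `r_{φ,div}(E^d)` (`Isogeny.twistDivRank`);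
* `hChil` — *"by [Chil21] if `E` is in Case V, we find that `E_0` is in Case IV"* (for a balanced
  `φ : E → E_0`);
* `hmod`, `hMon` — Modularity and Monsky's `2`-parity congruence, the tree's route to the parity
  half `(-1)^{r_{2^∞}(E^d)} = w(E^d)` and the equidistribution of `w(E^d)` (display (1.2);
  `BSDSelmerSmithRootNumberDensityProofs`).
Conclusion: `smith_selmerCorank_density E` (Thm. 1.1) for every elliptic curve `E / ℚ`. Proof as
printed: put `E` in `a₁ = a₃ = 0` form; it is in one of Cases I–V (`smithCase_exhaustive`);
Cases I, II by `hSmi`; Cases IV, V by the isogeny trick (Thm. 1.7); Case III by the isogeny to a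
curve in Case I, IV or V. [cite: arXiv250317619, Thm. 1.1 (proof, §1.1) and Thm. 1.7 (proof, §1.2)] -/
theorem smith_selmerCorank_density_of_printed_inputs (E : WeierstrassCurve ℚ) [E.IsElliptic] :
    smith_selmerCorank_density E := by
  obtain ⟨C, hC⟩ := exists_variableChange_isCharNeTwoNF E
  haveI := hC
  have hs : smith_selmerCorank_density (C • E) := by
    rcases smithCase_exhaustive (C • E) with hI | hII | hIII | hIV | hV
    · exact hSmi _ (Or.inl hI)
    · exact hSmi _ (Or.inr hII)
    · exact smith_selmerCorank_density_of_smithCaseIII hmod hMon hSmi h17IV h17V hChil _ hIII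
    · exact smith_selmerCorank_density_of_smithCaseIV hmod hMon h17IV h17V hChil _ hIV
    · exact smith_selmerCorank_density_of_smithCaseV hmod hMon h17IV h17V hChil _ hV
  exact smith_selmerCorank_density_of_isogeny (VariableChange.toIsogeny E C) hs

end Assembly

end Literature.NumberTheory.EllipticCurves

end
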